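/-
COR-CM (cell pub-hodgecm2, stage 2 of the Hodge ladder) — count-neutral KERNEL COMBINATORICS «the least generating face number of every Galois CM
field of twist type ℤ/2^{j+1} × B is the coinvariant invariant φ₂ — every j ≥ 0, every finite B» (seat prover-pub-hodgecm2-b09-g37-0, binder prover
b09, gen 37; claim UNIFORM SCREW LAW, HOME/INBOX.md l.17696 / INTERIM #3 l.18646).  Theorems only; no geometry beyond the tree's `Face` / `faceOfG`, no
`Universe` field touched, no named fact, nothing asserted; this seat's capstone `Census/TwistCensusComplete.lean`, the abelian normal form `Census/AbelianTwistDatum.lean`, its two-column law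
(`Census/TwistTwoColumnLaw.lean`) and seat b23's generic transfer (`CorCM/FaceGenerationTransfer.lean`) are used BY NAME; `Interfaces.lean` (C1),
every E term, B01, `Transposition/*`, `PortJoin/*`, `D2Bridge/*` are untouched.
HONEST FRAMING (COORDINATOR RULING — HODGE FRAMING CORRECTION, 2026-08-21T11:55:35Z): `HC_CM` is NOT proved, here or anywhere in the tree; this file
produces no period and proves no face period for any field.
T5: n/a-class — the only Prop hypothesis binders displayed are the datum equations (`θ (P * Q) = θ P + θ Q`, `θ conjT = (n, 0)`), `n = 2^j`, `2 ≤ n`,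
`2 ≤ |B|`, the commutativity of `GalT F` / `Aut(F)` and INT2-GEN's `hgen` inside the `IsLeast` sets; no named-fact / conjecture-def binder; checker: self
(prover-pub-hodgecm2-b09-g37-0), 2026-08-24.
-/
import Summits.HodgeConjecture.CorCM.Census.AbelianTwistDatum
import Summits.HodgeConjecture.CorCM.FaceTwistGenerationScrew
import Summits.HodgeConjecture.CorCM.FaceCensusOddSliceTransport
import HarnessLib

/-!
# Galois CM fields of twist type `ℤ/2^{j+1} × B`: the least generating face number is `φ₂`, for EVERY `j ≥ 0` and EVERY finite `B`

Let `F` be a Galois CM field with a TWIST DATUM `θ : GalT F ≃ ZMod (2n) × B`, multiplicative-to-additive, `θ conjT = (n, 0)`, of 2-power level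
`n = 2^j`, `j ≥ 0` (`Gal(F/ℚ) = ⟨u⟩ × B`, `u` central of order `2^{j+1}`, `u^{2^j} =` complex conjugation; `B` ANY finite group; `j = 0`: the fields
containing an imaginary quadratic field with Galois complement `B`, seat b23's `CorCM/FaceComplementGeneration.lean`; `B = 1`: the cyclic CM
fields).  For every base embedding `σ₀`:

* **`isLeast_card_faces_hgen_of_twist_fibreTwo`**: the least size of a set `𝒮` of rank-four faces of `F` with INT2-GEN's generation binder
  `hgen(𝒮, σ₀)` is EXACTLY the coinvariant invariant **`φ₂(GalT F, conjT)`** (`Census/CoinvariantFibre.fibreTwo`) — the field form of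
  `Census.TwistGeneration.isLeast_card_gfaces_generate` through `FaceTransfer.isLeast_card_faces_hgen_of_intrinsic`;
* **`isLeast_card_faces_hgen_of_comm`** / **`…_of_aut_comm`**: for EVERY Galois CM field with ABELIAN Galois group (commutative `GalT F`, resp.
  commutative `F ≃ₐ[ℚ] F`) and every base embedding, the least size of a face set with `hgen` is EXACTLY `φ₂(GalT F, conjT)` — via the abelian normal
  form `Census.TwistGeneration.exists_twist_datum` (`Census/AbelianTwistDatum.lean`);
* **`isLeast_card_faces_hgen_of_twist_of_two_le`** (`j ≥ 1`, `|B| ≥ 2`): the same least size in the block currency,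
  `β(F) − 1 − [∃ t ∈ B, 2^{j+1} ∣ ord t]` (`Census.TwistGeneration.complete_law_of_two_le`; `|B| ≥ 3` is `CorCM/FaceTwistGenerationScrew.lean`,
  `|B| = 2` is new: a cyclic CM field of degree `2^{j+1}` times a real quadratic field needs exactly `β(F) − 1` faces).
CONDITIONAL READING ONLY: these count the faces whose periods INT2-GEN would need; no period is produced; `HC_CM` is NOT proved.

References: [cite: Pohlmann1968, Thm. 1]; [cite: Milne1999LefschetzClasses, Thm. 3.2, Prop. 2.1]; [cite: Shimura1998, §6.2 Theorem 3 and §6.1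
Corollary of Theorem 2 (pp. 41–43), §8.1 (p. 62)].
-/

noncomputable section

open CategoryTheory NumberField NumberField.ComplexEmbedding
open Literature.AlgebraicGeometry Literature.AlgebraicGeometry.Motives Literature.AlgebraicGeometry.HodgeTheory
open Literature.AlgebraicGeometry.ComplexMultiplication Literature.AlgebraicGeometry.Milne1999
open Literature.NumberTheory.Automorphic
open Summit.HodgeConjecture.CorCM.Domination

namespace Summit.HodgeConjecture.CorCM.FaceTwist

open Summit.HodgeConjecture.CorCM.Prior.AllgGroup.RfwfAllgGroup
open Summit.HodgeConjecture.CorCM.Census.BlockParity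
open Summit.HodgeConjecture.CorCM.Census.Coinvariant
open Summit.HodgeConjecture.CorCM.Census

variable {F : Type} [Field F] [NumberField F]
variable {B : Type} [AddGroup B] [Fintype B]
variable {n : ℕ} [NeZero n]

/-- **THE LEAST GENERATING FACE NUMBER OF A GALOIS CM FIELD OF TWIST TYPE IS `φ₂`** (every 2-power level `n = 2^j`, `j ≥ 0`, every finite `B`):
for every base embedding `σ₀`, the least size of a face set `𝒮` with `hgen(𝒮, σ₀)` is `fibreTwo conjT`. [folklore] -/
theorem isLeast_card_faces_hgen_of_twist_fibreTwo [IsCMField F] [IsGalois ℚ F] (θ : GalT F ≃ ZMod (2 * n) × B)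
    (hθ : ∀ P Q : GalT F, θ (P * Q) = θ P + θ Q) (hθc : θ conjT = (((n : ℕ) : ZMod (2 * n)), 0)) {j : ℕ} (hj : n = 2 ^ j)
    (σ₀ : F →+* ℂ) :
    IsLeast {m : ℕ | ∃ 𝒮 : Finset (Face F), 𝒮.card = m ∧
      ∀ f : Face F, lefChar f.corner (fun _ => ({σ₀} : Finset (F →+* ℂ))) ∈ AddSubgroup.closure
        {a : Asym F | ∃ g ∈ (𝒮 : Set (Face F)), ∃ σ : F →+* ℂ, a = lefChar g.corner (fun _ => ({σ} : Finset (F →+* ℂ)))}}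
      (fibreTwo (conjT : GalT F) conjT_mul_self) := by
  obtain ⟨⟨S, hS, hcard, hgenr⟩, hfloor⟩ := TwistGeneration.exists_gfaces_generate_card_eq_fibreTwo_all θ hθ hθc conjT_mul_self hj
  refine FaceTransfer.isLeast_card_faces_hgen_of_intrinsic _ ⟨S, hS, hcard.le, hgenr⟩ (fun S₀ hS₀ hgen₀ => ?_) σ₀
  exact hfloor S₀ hS₀ fun y hy => hgen₀ (gfaceSet_subset_hodgeSpan _ _ hy)

open Classical in
/-- **THE COMPLETE COUNT FOR EVERY COMPLEMENT OF ORDER `≥ 2`.**  `n = 2^j ≥ 2`, `|B| ≥ 2`: for every base embedding `σ₀`, the least size of a face set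
`𝒮` with `hgen(𝒮, σ₀)` is EXACTLY `β(F) − 1 − [∃ t ∈ B, 2n ∣ ord t]` (the case `|B| = 2` — a cyclic CM field of degree `2^{j+1}` times a real quadratic
field — is the two-column law: exactly `β(F) − 1`). [folklore] -/
theorem isLeast_card_faces_hgen_of_twist_of_two_le [IsCMField F] [IsGalois ℚ F] (θ : GalT F ≃ ZMod (2 * n) × B)
    (hθ : ∀ P Q : GalT F, θ (P * Q) = θ P + θ Q) (hθc : θ conjT = (((n : ℕ) : ZMod (2 * n)), 0)) {j : ℕ} (hj : n = 2 ^ j) (hn : 2 ≤ n)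
    (h2 : 2 ≤ Fintype.card B) (σ₀ : F →+* ℂ) :
    IsLeast {m : ℕ | ∃ 𝒮 : Finset (Face F), 𝒮.card = m ∧
      ∀ f : Face F, lefChar f.corner (fun _ => ({σ₀} : Finset (F →+* ℂ))) ∈ AddSubgroup.closure
        {a : Asym F | ∃ g ∈ (𝒮 : Set (Face F)), ∃ σ : F →+* ℂ, a = lefChar g.corner (fun _ => ({σ} : Finset (F →+* ℂ)))}}
      (Fintype.card (Block (conjT : GalT F)) - (if ∃ t : B, 2 * n ∣ addOrderOf t then 2 else 1)) := by
  obtain ⟨⟨S, hS, hcard, hgenr⟩, hfloor⟩ := TwistGeneration.complete_law_of_two_le θ hθ hθc conjT_mul_self hj hn h2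
  refine FaceTransfer.isLeast_card_faces_hgen_of_intrinsic _ ⟨S, hS, by omega, hgenr⟩ (fun S₀ hS₀ hgen₀ => ?_) σ₀
  have h := hfloor S₀ hS₀ fun y hy => hgen₀ (gfaceSet_subset_hodgeSpan _ _ hy)
  omega

open Classical in
/-- **The twist-type count equals `φ₂`** (`j ≥ 1`, `|B| ≥ 2`): `β(F) − 1 − [∃ t ∈ B, 2n ∣ ord t] = fibreTwo conjT`. [folklore] -/
theorem card_block_sub_eq_fibreTwo_of_twist [IsCMField F] [IsGalois ℚ F] (θ : GalT F ≃ ZMod (2 * n) × B)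
    (hθ : ∀ P Q : GalT F, θ (P * Q) = θ P + θ Q) (hθc : θ conjT = (((n : ℕ) : ZMod (2 * n)), 0)) {j : ℕ} (hj : n = 2 ^ j) (hn : 2 ≤ n)
    (h2 : 2 ≤ Fintype.card B) (σ₀ : F →+* ℂ) :
    Fintype.card (Block (conjT : GalT F)) - (if ∃ t : B, 2 * n ∣ addOrderOf t then 2 else 1) = fibreTwo (conjT : GalT F) conjT_mul_self :=
  (isLeast_card_faces_hgen_of_twist_of_two_le θ hθ hθc hj hn h2 σ₀).unique (isLeast_card_faces_hgen_of_twist_fibreTwo θ hθ hθc hj σ₀)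

/-- **EVERY GALOIS CM FIELD WITH ABELIAN GALOIS TRANSLATES: the least generating face number is `φ₂`.**  For `F` Galois CM whose group of
Galois translates `GalT F` is commutative (every ABELIAN CM field: cyclotomic fields, their CM subfields, …) and every base embedding `σ₀`, the
least size of a face set `𝒮` with `hgen(𝒮, σ₀)` is EXACTLY `fibreTwo conjT` — the abelian normal form (`Census.TwistGeneration.exists_twist_datum`)
puts `(GalT F, conjT)` in twist form `ℤ/2^{j+1} × B`, and the twisted census applies. [folklore] -/
theorem isLeast_card_faces_hgen_of_comm [IsCMField F] [IsGalois ℚ F] (hcomm : ∀ P Q : GalT F, P * Q = Q * P) (σ₀ : F →+* ℂ) :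
    IsLeast {m : ℕ | ∃ 𝒮 : Finset (Face F), 𝒮.card = m ∧
      ∀ f : Face F, lefChar f.corner (fun _ => ({σ₀} : Finset (F →+* ℂ))) ∈ AddSubgroup.closure
        {a : Asym F | ∃ g ∈ (𝒮 : Set (Face F)), ∃ σ : F →+* ℂ, a = lefChar g.corner (fun _ => ({σ} : Finset (F →+* ℂ)))}}
      (fibreTwo (conjT : GalT F) conjT_mul_self) := by
  letI : CommGroup (GalT F) := { (inferInstance : Group (GalT F)) with mul_comm := hcomm }
  obtain ⟨j, B, _, _, θ, hθ, hθc⟩ := TwistGeneration.exists_twist_datum (G := GalT F) conjT_mul_self conjT_ne_one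
  obtain ⟨⟨S, hS, hcard, hgenr⟩, hfloor⟩ :=
    TwistGeneration.exists_gfaces_generate_card_eq_fibreTwo_all (n := 2 ^ j) θ hθ hθc conjT_mul_self rfl
  refine FaceTransfer.isLeast_card_faces_hgen_of_intrinsic _ ⟨S, hS, hcard.le, hgenr⟩ (fun S₀ hS₀ hgen₀ => ?_) σ₀
  exact hfloor S₀ hS₀ fun y hy => hgen₀ (gfaceSet_subset_hodgeSpan _ _ hy)

/-- **… in terms of the automorphism group**: if `Aut(F) = F ≃ₐ[ℚ] F` is commutative (Mathlibʼs abelian Galois extensions), the least generating face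
number of `F` at every base embedding is `fibreTwo conjT`. [folklore] -/
theorem isLeast_card_faces_hgen_of_aut_comm [IsCMField F] [IsGalois ℚ F] (hab : ∀ g h : F ≃ₐ[ℚ] F, g * h = h * g) (σ₀ : F →+* ℂ) :
    IsLeast {m : ℕ | ∃ 𝒮 : Finset (Face F), 𝒮.card = m ∧
      ∀ f : Face F, lefChar f.corner (fun _ => ({σ₀} : Finset (F →+* ℂ))) ∈ AddSubgroup.closure
        {a : Asym F | ∃ g ∈ (𝒮 : Set (Face F)), ∃ σ : F →+* ℂ, a = lefChar g.corner (fun _ => ({σ} : Finset (F →+* ℂ)))}}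
      (fibreTwo (conjT : GalT F) conjT_mul_self) := by
  refine isLeast_card_faces_hgen_of_comm (fun P Q => ?_) σ₀
  apply (FaceCensus.OddSlice.galTOfAut σ₀).symm.injective
  rw [FaceCensus.OddSlice.galTOfAut_symm_mul, FaceCensus.OddSlice.galTOfAut_symm_mul, hab]

end Summit.HodgeConjecture.CorCM.FaceTwist

end
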